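import Mathlib
import HarnessLib
import Summits.HubbardSuperconductivity.HubbardSuperconductivity.Theorems.KLProgrammeKLRegimeEngineTowerRemeasureWt
import Summits.HubbardSuperconductivity.HubbardSuperconductivity.Theorems.KLProgrammeKLRegimeEngineTowerRemeasureLevAbs

/-!
# Route `KLProgramme` — crux K3 ENGINE (stmt-HubbardSuperconductivity-20437 `KLRegimeEngineV17F2`), stub (b) v2, THE LEVELS PACKAGE (ℓ), instantiation (I2),
# THE WEIGHTED JUMP WITH THE SECOND CONSERVATION GAIN — a weighted pinned sum re-measured at `F_{J′}` is at most `C_m·(2^{J′})^{m−2}` times the coarse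
# weighted carriers; the scale-`0` action's summand (located item «UV-REMEASURE-COUNT», decision (b) «COUNTING», count «ABS-UMK-COUNT», weighted track)

Cell gate-hubbard-kl, seat p4 g17 (count side).  k3c2-p3's `EngineV8.klWtPinnedSumAt_jump_le_of_consts` (…EngineTowerRemeasureWt §2) pays the relative count
with the pinned leg fixed and ONE further leg determined by conservation (`hcnt`, exponent `m − 1`); for the `k′ = 0` summand of E1's
`klTowerMeasWt_le_remeasured_sum` (the scale-`0` action `𝒱_0` re-measured at `F_{dk−1}`) this is flat against the allowance `g^{(p−2)k}` at every degree
(memo UV-REMEASURE-COUNT §2, weighted track).  This file is the weighted twin of …EngineTowerRemeasureLevAbs (p4 g16, levelled carrier): the SAME tree-weighted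
re-sectorisation (`hubbardSectorPrescribedSumWt_klAniso_jump_le_split`, empty on-class set) run on the ABSOLUTE count with the second conservation gain,
`PerturbedFermiCurve.card_relCount_prescribed_absUmklapp_klAniso_le_window` (exponent `(m+1) − |E| − 2`, umklapp strings included, `|E| + 5 ≤ m + 1`; here
`E = {q}` is the pinned leg, so `6 ≤ m + 1`):

* §1 `pinnedLeg_count_arith_abs` — `27 · (D^{m+1}·(2^{J′})^{(m+1)−1−2}) ≤ D^{m+1}·27^{m+1}·(2^{J′})^{m−2}`;
* §2 **`klWtPinnedSumAt_jump_le_of_consts_abs`** — the weighted jump (any rate `j`) at abstract pair-weighted overlap constants `c₁, c₁r` with the absolute count: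
  for `5 ≤ m`, `klWtPinnedSumAt … J′ j (m+1) T q w ≤ c₁^m·c₁r·ε^{m+1}·(D^{m+1}·27^{m+1})·(2^{J′})^{m−2}·N` — growth `N^{L−3}` in the number of legs `L = m + 1`;
* §3 **`klWtPinnedSumAt_jump_le_of_overlap_abs`** — the COUNT DISCHARGED on the covariance window / admissible frames / regime thresholds (`D` before `m` and `R`),
  the pair-weighted overlap constants LEFT ABSTRACT: the window-free general-jump supplier of the located item «(I2)-WT-WINDOW» (k3c3-p2 lineage, design
  I2-WT-WINDOW-DESIGN (X2)), or any other, plugs in without a re-key;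
* §4 **`klWtPinnedSumAt_jump_le_klEng_flow_deep_abs (dd m)`** — drop-in twin of k3c2-p3's `klWtPinnedSumAt_jump_le_klEng_flow_deep` (flow frame `K_n`, p3's deep
  window `4ⁿ·U ≤ 4^{2(k+1)+dd}`, p3's binder list verbatim + the count's thresholds), exponent `m − 2` in place of `m − 1`, ABSOLUTE in `J′`;
* §5 **`klWtPinnedSumAt_scaleZero_remeasure_le_of_overlap_abs`** / **`…_le_klEng_flow_deep_abs`** — THE SCALE-`0` ACTION `𝒱_0[K]` RE-MEASURED AT `F_{J′}` (coarse
  family `F_0`, any rate `j ≥ J′`): `klWtPinnedSumAt … J′ j (m+1) 𝒱_0 q w ≤ C·(2^{J′})^{m−2}·N₀` whenever the level-`0` weighted carriers `klWtPinnedSum … 0 (m+1) q w′`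
  are `≤ N₀` (rate domination `klWtPinnedSumAt_le_klWtPinnedSumOf`) — the `k′ = 0` summand of `klTowerMeasWt_le_remeasured_sum` with growth `N^{(2p)−3}`, the shape
  UV-REMEASURE-COUNT §2 shows closes against `g^{(p−2)k}`; its supplier is the level-`0` law (`levelZero_norms_frame_of_isRaiseOf_U10L4`, E1-LEVELS-BLUEPRINT v5 §1 (α)).
No `abs34` weighted twin: the pinned track prescribes one leg, so `2p ≥ 6` legs always leave `≥ 5` free; the quartic is the (I4) import (`klThinCountC`).
Everything is proved; no definitions; nothing about the model is asserted; nothing asserts superconductivity; the dimensionless dictionary is E1's (I6)/(I7).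
References: BGM 2006 §2.8 (2.76), (2.82)–(2.84), (2.88)–(2.90), App. A3 Lemma A3.1 [cite: BenfattoGiulianiMastropietro2006]; BGM 2003 §3.1 Lemma 3.1 (4.3)
[cite: BenfattoGiulianiMastropietro2003].
-/

noncomputable section

namespace Summit.HubbardSuperconductivity.HubbardSuperconductivity.Theorems.EngineV8

set_option linter.dupNamespace false -- summit = problem name (single-conjunct summit), D-0017

open Classical
open Real Finset Literature.MathematicalPhysics.QuantumLattice Literature.Probability.LatticeModels GrassmannAlgebra
open Literature.Probability.LatticeModels.BattleFederbush
open Literature.MathematicalPhysics.QuantumLattice.FermiRG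
open Summit.HubbardSuperconductivity.HubbardSuperconductivity.Theorems.KLRegimeSplit
open Summit.HubbardSuperconductivity.HubbardSuperconductivity.Theorems.KLProgrammeLegKernels
open Summit.HubbardSuperconductivity.HubbardSuperconductivity.Theorems.DispersionFlow
open Summit.HubbardSuperconductivity.HubbardSuperconductivity.Theorems.KLRegimeWick
open Summit.HubbardSuperconductivity.HubbardSuperconductivity.Theorems.TorusFourierL2
open Summit.HubbardSuperconductivity.HubbardSuperconductivity.Theorems.PerturbedFermiCurve

variable {L M : ℕ} [NeZero L] [NeZero M]

/-! ## §1 The count arithmetic for the pinned leg -/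

omit [NeZero L] [NeZero M] in
/-- **The count arithmetic, absolute form, one prescribed leg**: `27^1 · (D^{m+1}·(2^{J′})^{(m+1)−1−2}) ≤ D^{m+1}·27^{m+1}·(2^{J′})^{m−2}` (`0 ≤ D`). -/
theorem pinnedLeg_count_arith_abs {D : ℝ} (hD : 0 ≤ D) (J' m : ℕ) :
    (27 : ℝ) ^ 1 * (D ^ (m + 1) * ((2 : ℝ) ^ J') ^ ((m + 1) - 1 - 2)) ≤ D ^ (m + 1) * 27 ^ (m + 1) * ((2 : ℝ) ^ J') ^ (m - 2) := by
  have h := legSet_count_arith_abs hD J' m 0 1 (by simp) (by omega)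
  have hexp : (m + 1) - max 0 1 - 2 = m - 2 := by simp
  rwa [hexp] at h

/-! ## §2 The weighted jump at abstract overlap constants, absolute count -/

/-- **THE WEIGHTED JUMP at abstract constants WITH THE ABSOLUTE COUNT** (BGM 2006 (2.82)–(2.84), (2.88)–(2.90); BGM 2003 Lemma 3.1; any rate `j`).  As
`klWtPinnedSumAt_jump_le_of_consts`, with the counting hypothesis replaced by the absolute count with the second conservation gain
(`#{…} ≤ D^{m+1}·(2^{J′})^{(m+1)−|E|−2}` for `|E| + 5 ≤ m + 1`): for `5 ≤ m` (at least six legs), every pinned leg `q`, pin `w` and bound `N` of the coarse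
rate-`j` carriers at the same leg, `klWtPinnedSumAt … J′ j (m+1) T q w ≤ c₁^m·c₁r·ε^{m+1}·(D^{m+1}·27^{m+1})·(2^{J′})^{m−2}·N`.
[cite: BenfattoGiulianiMastropietro2006, §2.8 (2.82)-(2.84), (2.88)-(2.90); BenfattoGiulianiMastropietro2003, §3.1 Lemma 3.1 (4.3)] -/
theorem klWtPinnedSumAt_jump_le_of_consts_abs {β : ℝ} (hβ : 0 < β) (μ : ℝ) (K : TrigPolyC4v) {k J' : ℕ} (hJ : k + 1 ≤ J')
    (T : HubbardGrassmann L M)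
    (hT : ∀ (m : ℕ) (X : Fin m → HubbardFieldIdx L M), ∑ i, signedMomentum L (X i).2 (X i).1.1.2 ≠ 0 → kernel ℂ T m X = 0)
    (j : ℕ) {c₁ c₁r D : ℝ} (hc₁0 : 0 ≤ c₁) (hc₁r0 : 0 ≤ c₁r) (hD : 0 ≤ D)
    (hcol₁ : ∀ (ω'' : Fin (sectorCount J')) (ω' : Fin (sectorCount k)) (σ c : Fin 2) (x' : SpaceTimeIdx L M),
      ∑ x'' : SpaceTimeIdx L M, ‖(sectorAnalysisMatrix L M β (klAnisoFamily L M β μ K klE0 J') *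
        sectorSubMatrix L M β (bgmFatMultiplier L M klE0 β (nambuXiCT L μ K) k)) (x'', ((ω'', σ), c)) (x', ((ω', σ), c))‖ *
          klScaleWt L M β j
            {latticeLegPos (2 * (2 * M)) ((x'', ((ω'', σ), c)) : SpaceTimeIdx L M × SectorLeg (sectorCount J')),
              latticeLegPos (2 * (2 * M)) ((x', ((ω', σ), c)) : SpaceTimeIdx L M × SectorLeg (sectorCount k))} ≤ c₁)
    (hrow₁ : ∀ (ω'' : Fin (sectorCount J')) (ω' : Fin (sectorCount k)) (σ c : Fin 2) (x'' : SpaceTimeIdx L M),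
      ∑ x' : SpaceTimeIdx L M, ‖(sectorAnalysisMatrix L M β (klAnisoFamily L M β μ K klE0 J') *
        sectorSubMatrix L M β (bgmFatMultiplier L M klE0 β (nambuXiCT L μ K) k)) (x'', ((ω'', σ), c)) (x', ((ω', σ), c))‖ *
          klScaleWt L M β j
            {latticeLegPos (2 * (2 * M)) ((x'', ((ω'', σ), c)) : SpaceTimeIdx L M × SectorLeg (sectorCount J')),
              latticeLegPos (2 * (2 * M)) ((x', ((ω', σ), c)) : SpaceTimeIdx L M × SectorLeg (sectorCount k))} ≤ c₁r)
    (m : ℕ) (hm : 5 ≤ m)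
    (hcnt : ∀ (E : Finset (Fin (m + 1))) (τ'' : Fin (m + 1) → SectorLeg (sectorCount J'))
      (σ' : Fin (m + 1) → SectorLeg (sectorCount k)), E.card + 5 ≤ m + 1 →
      ((((bgmSectorSet L M (klAnisoFamily L M β μ K klE0 J') (m + 1)).filter fun σ'' => (∀ e ∈ E, σ'' e = τ'' e) ∧ ∀ i,
        (∃ q : FreqMomentum L M, klAnisoFamily L M β μ K klE0 J' (σ'' i).1.1 q ≠ 0 ∧
          bgmFatMultiplier L M klE0 β (nambuXiCT L μ K) k (σ' i).1.1 q ≠ 0) ∧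
        (σ' i).1.2 = (σ'' i).1.2 ∧ (σ' i).2 = (σ'' i).2).card : ℝ)) ≤
        D ^ (m + 1) * ((2 : ℝ) ^ J') ^ ((m + 1) - E.card - 2))
    (q : Fin (m + 1)) (w : SpaceTimeIdx L M × SectorLeg (sectorCount J')) {N : ℝ} (hN0 : 0 ≤ N)
    (hN : ∀ w' : SpaceTimeIdx L M × SectorLeg (sectorCount k), klWtPinnedSumAt L M β μ K k j (m + 1) T q w' ≤ N) :
    klWtPinnedSumAt L M β μ K J' j (m + 1) T q w ≤
      c₁ ^ m * c₁r * imagTimeWeight β M ^ (m + 1) * (D ^ (m + 1) * 27 ^ (m + 1)) * ((2 : ℝ) ^ J') ^ (m - 2) * N := by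
  have hε0 : 0 ≤ imagTimeWeight β M := imagTimeWeight_nonneg hβ.le M
  set ε := imagTimeWeight β M with hεdef
  set F' := klAnisoFamily L M β μ K klE0 J' with hF'
  set Fk := klAnisoFamily L M β μ K klE0 k with hFk
  set gpos : SpaceTimeIdx L M → ZMod (2 * (2 * M)) × TorusSite 2 L :=
    fun x => (((((2 * (x.1 : ℕ) : ℕ)) : ZMod (2 * (2 * M)))), x.2) with hgpos
  have hwt : IsTreeWeight (klScaleWt L M β j) := isTreeWeight_klScaleWt L M hβ.le j
  obtain ⟨y, ℓ⟩ := w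
  set E : Finset (Fin (m + 1)) := {q} with hE
  set τ'' : Fin (m + 1) → SectorLeg (sectorCount J') := fun _ => ℓ with hτ''
  have hqE : q ∈ E := by simp [hE]
  have hcard : E.card = 1 := by simp [hE]
  have hEcard : E.card + 5 ≤ m + 1 := by omega
  have hfilt : ∀ {Ns : ℕ} (ℓ₀ : SectorLeg Ns),
      (univ.filter fun σ : Fin (m + 1) → SectorLeg Ns => σ q = ℓ₀) = univ.filter fun σ => ∀ e ∈ E, σ e = (fun _ : Fin (m + 1) => ℓ₀) e := by
    intro Ns ℓ₀
    exact filter_congr fun σ _ => by simp [hE]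
  -- (1) the carrier at `F_{J′}` as the `E`-prescribed fine sum over `bgmSectorSet`
  have h1 : klWtPinnedSumAt L M β μ K J' j (m + 1) T q (y, ℓ) =
      ε ^ m * ∑ σ'' ∈ (bgmSectorSet L M F' (m + 1)).filter (fun σ'' => ∀ e ∈ E, σ'' e = τ'' e),
        ∑ x'' ∈ univ.filter (fun x'' : Fin (m + 1) → SpaceTimeIdx L M => x'' q = y),
          klScaleWt L M β j ((univ.image x'').image gpos) * ‖sectorisedKernel L M β F' T (m + 1) σ'' x''‖ := by
    rw [klWtPinnedSumAt_succ_eq_sum_sector, hfilt ℓ]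
    congr 1
    have hsub : (bgmSectorSet L M F' (m + 1)).filter (fun σ'' => ∀ e ∈ E, σ'' e = τ'' e) ⊆
        univ.filter (fun σ'' : Fin (m + 1) → SectorLeg (sectorCount J') => ∀ e ∈ E, σ'' e = τ'' e) :=
      filter_subset_filter _ (subset_univ _)
    refine (Finset.sum_subset hsub fun σ'' hσ''univ hσ''not => ?_).symm
    have hP := (mem_filter.1 hσ''univ).2
    have hnot : σ'' ∉ bgmSectorSet L M F' (m + 1) := fun h => hσ''not (mem_filter.2 ⟨h, hP⟩)
    exact sum_eq_zero fun x'' _ => by rw [sectorisedKernel_eq_zero_of_not_mem_bgmSectorSet β F' T hT hnot x'', norm_zero, mul_zero]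
  -- (2) the coarse `E`-prescribed sums are the coarse carriers
  have hN₁ : ∀ (τ' : Fin (m + 1) → SectorLeg (sectorCount k)) (y' : SpaceTimeIdx L M),
      ε ^ m * ∑ σ' ∈ univ.filter (fun σ' : Fin (m + 1) → SectorLeg (sectorCount k) => ∀ e ∈ E, σ' e = τ' e),
        ∑ x' ∈ univ.filter (fun x' : Fin (m + 1) → SpaceTimeIdx L M => x' q = y'),
          klScaleWt L M β j ((univ.image x').image gpos) * ‖sectorisedKernel L M β Fk T (m + 1) σ' x'‖ ≤ N := by
    intro τ' y'
    have hτ'E : (univ.filter fun σ' : Fin (m + 1) → SectorLeg (sectorCount k) => ∀ e ∈ E, σ' e = τ' e) =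
        univ.filter fun σ' => ∀ e ∈ E, σ' e = (fun _ : Fin (m + 1) => τ' q) e :=
      filter_congr fun σ _ => by simp [hE]
    rw [hτ'E, ← hfilt (τ' q), ← klWtPinnedSumAt_succ_eq_sum_sector]
    exact hN (y', τ' q)
  -- (3) the tree-weighted re-sectorisation lemma with the empty on-class set and the absolute count
  have hX0 : (0 : ℝ) ≤ D ^ (m + 1) * ((2 : ℝ) ^ J') ^ ((m + 1) - E.card - 2) := by positivity
  have h2 := hubbardSectorPrescribedSumWt_klAniso_jump_le_split (L := L) (M := M) hwt gpos hβ μ K hJ T hc₁0 hc₁r0 hX0 le_rfl hN0 le_rfl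
    hcol₁ hrow₁ m (bgmSectorSet L M F' (m + 1)) ∅ E τ'' q hqE (fun σ' _ => hcnt E τ'' σ' hEcard)
    (fun σ' h => absurd h (Finset.notMem_empty _)) hN₁ (fun τ' y' => by simp) y
  -- (4) assemble
  rw [h1]
  refine h2.trans ?_
  rw [zero_mul, add_zero]
  have harith : (27 : ℝ) ^ E.card * (D ^ (m + 1) * ((2 : ℝ) ^ J') ^ ((m + 1) - E.card - 2)) ≤
      D ^ (m + 1) * 27 ^ (m + 1) * ((2 : ℝ) ^ J') ^ (m - 2) := by
    rw [hcard]; exact pinnedLeg_count_arith_abs hD J' m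
  have hrest : 0 ≤ c₁ ^ m * c₁r * ε ^ (m + 1) * N := by positivity
  calc c₁ ^ m * c₁r * (27 : ℝ) ^ E.card * ε ^ m * (ε * (D ^ (m + 1) * ((2 : ℝ) ^ J') ^ ((m + 1) - E.card - 2) * N))
      = (c₁ ^ m * c₁r * ε ^ (m + 1) * N) * ((27 : ℝ) ^ E.card * (D ^ (m + 1) * ((2 : ℝ) ^ J') ^ ((m + 1) - E.card - 2))) := by ring
    _ ≤ (c₁ ^ m * c₁r * ε ^ (m + 1) * N) * (D ^ (m + 1) * 27 ^ (m + 1) * ((2 : ℝ) ^ J') ^ (m - 2)) :=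
        mul_le_mul_of_nonneg_left harith hrest
    _ = c₁ ^ m * c₁r * ε ^ (m + 1) * (D ^ (m + 1) * 27 ^ (m + 1)) * ((2 : ℝ) ^ J') ^ (m - 2) * N := by ring

/-! ## §3 The count discharged on the covariance window, the pair-weighted overlap constants abstract -/

/-- **THE WEIGHTED JUMP WITH THE SECOND CONSERVATION GAIN, COUNT DISCHARGED, OVERLAP ABSTRACT** — `D` is fixed before `m` and `R`; for every `R` with
`0 ≤ R.Gfr j` there are count thresholds `c₃′, U₀′ > 0` such that in the KL regime (`0 < c ≤ c₃′`, `0 < U ≤ U₀′`, `klBetaMin ≤ β ≤ e^{c/U²}`, `μ ∈ klWindowC`,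
`FrameOK R U (nScales β) ν K`), for ANY pair-weighted overlap constants `c₁, c₁r ≥ 0` of `‖E(klAnisoFamily J′)·S(F̃_k)‖` at rate `j` (supplied by the caller —
p3's deep-window lemma, or the window-free general-jump supplier of «(I2)-WT-WINDOW»), every momentum-conserving `T`, `k + 1 ≤ J′`, `5 ≤ m`:
`klWtPinnedSumAt … J′ j (m+1) T q w ≤ c₁^m·c₁r·ε^{m+1}·(D^{m+1}·27^{m+1})·(2^{J′})^{m−2}·N`.
[cite: BenfattoGiulianiMastropietro2006, §2.8 (2.82)-(2.84), (2.88)-(2.90); BenfattoGiulianiMastropietro2003, §3.1 Lemma 3.1 (4.3), §7.4] -/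
theorem klWtPinnedSumAt_jump_le_of_overlap_abs :
    ∃ D : ℝ, 0 < D ∧ ∀ R : RenConsts, (∀ j, 0 ≤ R.Gfr j) → ∃ c₃' : ℝ, 0 < c₃' ∧ ∃ U₀' : ℝ, 0 < U₀' ∧
      ∀ c : ℝ, 0 < c → c ≤ c₃' → ∀ U : ℝ, 0 < U → U ≤ U₀' → ∀ β : ℝ, klBetaMin ≤ β → β ≤ Real.exp (c / U ^ 2) →
      ∀ μ ∈ klWindowC, ∀ (ν : ℝ) (K : TrigPolyC4v), FrameOK R U (nScales β) ν K →
      ∀ (L M : ℕ) [NeZero L] [NeZero M] (k J' : ℕ), k + 1 ≤ J' →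
      ∀ T : HubbardGrassmann L M,
        (∀ (m' : ℕ) (X : Fin m' → HubbardFieldIdx L M), ∑ i, signedMomentum L (X i).2 (X i).1.1.2 ≠ 0 → kernel ℂ T m' X = 0) →
      ∀ (j : ℕ) (c₁ c₁r : ℝ), 0 ≤ c₁ → 0 ≤ c₁r →
        (∀ (ω'' : Fin (sectorCount J')) (ω' : Fin (sectorCount k)) (σ c : Fin 2) (x' : SpaceTimeIdx L M),
          ∑ x'' : SpaceTimeIdx L M, ‖(sectorAnalysisMatrix L M β (klAnisoFamily L M β μ K klE0 J') *
            sectorSubMatrix L M β (bgmFatMultiplier L M klE0 β (nambuXiCT L μ K) k)) (x'', ((ω'', σ), c)) (x', ((ω', σ), c))‖ *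
              klScaleWt L M β j
                {latticeLegPos (2 * (2 * M)) ((x'', ((ω'', σ), c)) : SpaceTimeIdx L M × SectorLeg (sectorCount J')),
                  latticeLegPos (2 * (2 * M)) ((x', ((ω', σ), c)) : SpaceTimeIdx L M × SectorLeg (sectorCount k))} ≤ c₁) →
        (∀ (ω'' : Fin (sectorCount J')) (ω' : Fin (sectorCount k)) (σ c : Fin 2) (x'' : SpaceTimeIdx L M),
          ∑ x' : SpaceTimeIdx L M, ‖(sectorAnalysisMatrix L M β (klAnisoFamily L M β μ K klE0 J') *
            sectorSubMatrix L M β (bgmFatMultiplier L M klE0 β (nambuXiCT L μ K) k)) (x'', ((ω'', σ), c)) (x', ((ω', σ), c))‖ *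
              klScaleWt L M β j
                {latticeLegPos (2 * (2 * M)) ((x'', ((ω'', σ), c)) : SpaceTimeIdx L M × SectorLeg (sectorCount J')),
                  latticeLegPos (2 * (2 * M)) ((x', ((ω', σ), c)) : SpaceTimeIdx L M × SectorLeg (sectorCount k))} ≤ c₁r) →
      ∀ m : ℕ, 5 ≤ m → ∀ (q : Fin (m + 1)) (w : SpaceTimeIdx L M × SectorLeg (sectorCount J')) (N : ℝ), 0 ≤ N →
        (∀ w' : SpaceTimeIdx L M × SectorLeg (sectorCount k), klWtPinnedSumAt L M β μ K k j (m + 1) T q w' ≤ N) →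
        klWtPinnedSumAt L M β μ K J' j (m + 1) T q w ≤
          c₁ ^ m * c₁r * imagTimeWeight β M ^ (m + 1) * (D ^ (m + 1) * 27 ^ (m + 1)) * ((2 : ℝ) ^ J') ^ (m - 2) * N := by
  obtain ⟨D, hD, hreg⟩ := card_relCount_prescribed_absUmklapp_klAniso_le_window
  refine ⟨D, hD, fun R hRj => ?_⟩
  obtain ⟨c₃, hc₃, U₀, hU₀, hcnt⟩ := hreg R hRj
  refine ⟨c₃, hc₃, U₀, hU₀, ?_⟩
  intro c hc hc₃' U hU hU₀' β hβmin hβc μ hμ ν K hK L M _ _ k J' hJ T hT j c₁ c₁r hc₁0 hc₁r0 hcol₁ hrow₁ m hm q w N hN0 hN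
  have hβ : 0 < β := KLRegimeSplit.pos_of_klBetaMin_le hβmin
  exact klWtPinnedSumAt_jump_le_of_consts_abs hβ μ K hJ T hT j hc₁0 hc₁r0 hD.le hcol₁ hrow₁ m hm
    (fun E τ'' σ' hE => hcnt c hc hc₃' U hU hU₀' β hβmin hβc μ hμ ν K hK L M m k J' _ subset_rfl E τ'' σ' hE) q w hN0 hN

/-! ## §4 The weighted jump at the flow frame on p3's deep window, constants discharged -/

/-- **THE WEIGHTED JUMP WITH THE SECOND CONSERVATION GAIN IN THE KL REGIME AT THE FLOW FRAME, constants discharged on the deep window** — drop-in twin of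
`klWtPinnedSumAt_jump_le_klEng_flow_deep` (p3's binder list of `overlapWt_jump_sums_klEng_flow_deep dd` verbatim + the count's thresholds `cc ≤ c₃′(R)`,
`U ≤ U₀′(R)`): for every number of legs `m + 1 ≥ 6` there is `C_m > 0` with, for every momentum-conserving `T`, rate `j ≥ J′`, pinned leg `q`, pin `w` and bound
`N` of the coarse carriers, `klWtPinnedSumAt … J′ j (m+1) T q w ≤ C_m·(2^{J′})^{m−2}·N` at `K = K_n` (ABSOLUTE in `J′`).
[cite: BenfattoGiulianiMastropietro2006, §2.8 (2.82)-(2.84), (2.88)-(2.90); BenfattoGiulianiMastropietro2003, §3.1 Lemma 3.1 (4.3)] -/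
theorem klWtPinnedSumAt_jump_le_klEng_flow_deep_abs (dd m : ℕ) (hm : 5 ≤ m) :
    ∃ C : ℝ, 0 < C ∧ ∀ R : RenConsts, R.WF2 → ∃ c₃' : ℝ, 0 < c₃' ∧ ∃ U₀' : ℝ, 0 < U₀' ∧
      ∀ (G : GeoConsts) (P : SplitConsts) (Q : EngConsts) (cc : ℝ), 0 < cc → cc ≤ klEngC₃6 P R → cc ≤ c₃' →
      ∀ μ ∈ klWindowC, ∀ U : ℝ, 0 < U → U ≤ min (klEngU₀3 P R cc) (1 / (R.Gfr 3 + 1)) → U ≤ U₀' →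
      ∀ β : ℝ, klBetaMin ≤ β → β ≤ Real.exp (cc / U ^ 2) →
      ∀ (L M : ℕ) [NeZero L] [NeZero M], klEngL₃ β U ≤ L → klEngM₃ β U L ≤ M →
      ∀ n : ℕ, 1 ≤ n → n ≤ nScales β + 1 →
        HistP klPredsV17F2 L M G P Q R β U μ 0 n → FrameOK R U (nScales β) μ (klFlowFrameU L M β U μ n) →
        ∀ k J' : ℕ, k + 1 ≤ J' → J' ≤ n → (4 : ℝ) ^ n * U ≤ (4 : ℝ) ^ (2 * (k + 1) + dd) →
        ∀ T : HubbardGrassmann L M,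
          (∀ (m' : ℕ) (X : Fin m' → HubbardFieldIdx L M), ∑ i, signedMomentum L (X i).2 (X i).1.1.2 ≠ 0 → kernel ℂ T m' X = 0) →
        ∀ j : ℕ, J' ≤ j → ∀ (q : Fin (m + 1)) (w : SpaceTimeIdx L M × SectorLeg (sectorCount J')) (N : ℝ), 0 ≤ N →
          (∀ w' : SpaceTimeIdx L M × SectorLeg (sectorCount k),
            klWtPinnedSumAt L M β μ (klFlowFrameU L M β U μ n) k j (m + 1) T q w' ≤ N) →
          klWtPinnedSumAt L M β μ (klFlowFrameU L M β U μ n) J' j (m + 1) T q w ≤ C * ((2 : ℝ) ^ J') ^ (m - 2) * N := by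
  obtain ⟨CJ, hCJ, hov⟩ := overlapWt_jump_sums_klEng_flow_deep dd
  obtain ⟨D, hD, hreg⟩ := klWtPinnedSumAt_jump_le_of_overlap_abs
  refine ⟨(3 * CJ / 2) ^ (m + 1) * (D ^ (m + 1) * 27 ^ (m + 1)), by positivity, fun R hR2 => ?_⟩
  have hRj : ∀ j, 0 ≤ R.Gfr j := gfr_nonneg_of_wf2 hR2
  obtain ⟨c₃, hc₃, U₀, hU₀, hjump⟩ := hreg R hRj
  refine ⟨c₃, hc₃, U₀, hU₀, ?_⟩
  intro G P Q cc hcc hcc6 hcc₃' μ hμ U hU hUle hU₀' β hβmin hβc L M _ _ hL3 hM3 n hn1 hnN hhist hfr k J' hJ hJn hwin T hT j hjJ q w N hN0 hN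
  have hβ : 0 < β := KLRegimeSplit.pos_of_klBetaMin_le hβmin
  set K : TrigPolyC4v := klFlowFrameU L M β U μ n with hK
  obtain ⟨_, hcolJ, hrowJ⟩ := hov G P R Q cc hR2 hcc hcc6 μ hμ U hU hUle β hβmin hβc L M hL3 hM3 n hn1 hnN hhist hfr k J' hJ hJn hwin
  have hc₁0 : (0 : ℝ) ≤ 3 * CJ * M / β := by positivity
  -- rate `j ≥ J′`: the weight only decreases
  have hcol₁ : ∀ (ω'' : Fin (sectorCount J')) (ω' : Fin (sectorCount k)) (σ c : Fin 2) (x' : SpaceTimeIdx L M),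
      ∑ x'' : SpaceTimeIdx L M, ‖(sectorAnalysisMatrix L M β (klAnisoFamily L M β μ K klE0 J') *
        sectorSubMatrix L M β (bgmFatMultiplier L M klE0 β (nambuXiCT L μ K) k)) (x'', ((ω'', σ), c)) (x', ((ω', σ), c))‖ *
          klScaleWt L M β j
            {latticeLegPos (2 * (2 * M)) ((x'', ((ω'', σ), c)) : SpaceTimeIdx L M × SectorLeg (sectorCount J')),
              latticeLegPos (2 * (2 * M)) ((x', ((ω', σ), c)) : SpaceTimeIdx L M × SectorLeg (sectorCount k))} ≤ 3 * CJ * M / β := by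
    intro ω'' ω' σ c x'
    refine le_trans (sum_le_sum fun x'' _ => mul_le_mul_of_nonneg_left (klScaleWt_le_of_le β hjJ _) (norm_nonneg _)) ?_
    exact hcolJ ω'' ω' σ c x'
  have hrow₁ : ∀ (ω'' : Fin (sectorCount J')) (ω' : Fin (sectorCount k)) (σ c : Fin 2) (x'' : SpaceTimeIdx L M),
      ∑ x' : SpaceTimeIdx L M, ‖(sectorAnalysisMatrix L M β (klAnisoFamily L M β μ K klE0 J') *
        sectorSubMatrix L M β (bgmFatMultiplier L M klE0 β (nambuXiCT L μ K) k)) (x'', ((ω'', σ), c)) (x', ((ω', σ), c))‖ *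
          klScaleWt L M β j
            {latticeLegPos (2 * (2 * M)) ((x'', ((ω'', σ), c)) : SpaceTimeIdx L M × SectorLeg (sectorCount J')),
              latticeLegPos (2 * (2 * M)) ((x', ((ω', σ), c)) : SpaceTimeIdx L M × SectorLeg (sectorCount k))} ≤ 3 * CJ * M / β := by
    intro ω'' ω' σ c x''
    refine le_trans (sum_le_sum fun x' _ => mul_le_mul_of_nonneg_left (klScaleWt_le_of_le β hjJ _) (norm_nonneg _)) ?_
    exact hrowJ ω'' ω' σ c x''
  have h := hjump cc hcc hcc₃' U hU hU₀' β hβmin hβc μ hμ μ K hfr L M k J' hJ T hT j _ _ hc₁0 hc₁0 hcol₁ hrow₁ m hm q w N hN0 hN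
  have hMne : (M : ℝ) ≠ 0 := by exact_mod_cast NeZero.ne M
  have hεc : imagTimeWeight β M * (3 * CJ * M / β) = 3 * CJ / 2 := by
    unfold imagTimeWeight; field_simp
  have hconst : (3 * CJ * M / β) ^ m * (3 * CJ * M / β) * imagTimeWeight β M ^ (m + 1) = (3 * CJ / 2) ^ (m + 1) := by
    rw [← pow_succ, ← mul_pow, mul_comm (3 * CJ * M / β), hεc]
  calc klWtPinnedSumAt L M β μ K J' j (m + 1) T q w
      ≤ (3 * CJ * M / β) ^ m * (3 * CJ * M / β) * imagTimeWeight β M ^ (m + 1) * (D ^ (m + 1) * 27 ^ (m + 1)) *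
          ((2 : ℝ) ^ J') ^ (m - 2) * N := h
    _ = (3 * CJ / 2) ^ (m + 1) * (D ^ (m + 1) * 27 ^ (m + 1)) * ((2 : ℝ) ^ J') ^ (m - 2) * N := by rw [hconst]

/-! ## §5 The scale-`0` action re-measured at `F_{J′}` with the second conservation gain, weighted track -/

/-- **THE SCALE-`0` ACTION `𝒱_0[K]` RE-MEASURED AT `F_{J′}`, WEIGHTED TRACK, SECOND CONSERVATION GAIN, OVERLAP ABSTRACT** (`1 ≤ J′`, any rate `j ≥ J′`, count
discharged as in §3): for ANY pair-weighted overlap constants `c₁, c₁r ≥ 0` of `‖E(klAnisoFamily J′)·S(F̃_0)‖` at rate `j`, `5 ≤ m`, every pinned leg `q` and pin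
`w`, `klWtPinnedSumAt … J′ j (m+1) 𝒱_0 q w ≤ c₁^m·c₁r·ε^{m+1}·(D^{m+1}·27^{m+1})·(2^{J′})^{m−2}·N₀` whenever the level-`0` weighted carriers
`klWtPinnedSum … K 0 (m+1) q w′` are `≤ N₀` — the `k′ = 0` summand of `klTowerMeasWt_le_remeasured_sum` with growth `N^{L−3}`; its supplier is the level-`0` law.
[cite: BenfattoGiulianiMastropietro2006, §2.8 (2.82)-(2.84); BenfattoGiulianiMastropietro2003, §3.1 Lemma 3.1 (4.3)] -/
theorem klWtPinnedSumAt_scaleZero_remeasure_le_of_overlap_abs :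
    ∃ D : ℝ, 0 < D ∧ ∀ R : RenConsts, (∀ j, 0 ≤ R.Gfr j) → ∃ c₃' : ℝ, 0 < c₃' ∧ ∃ U₀' : ℝ, 0 < U₀' ∧
      ∀ c : ℝ, 0 < c → c ≤ c₃' → ∀ U : ℝ, 0 < U → U ≤ U₀' → ∀ β : ℝ, klBetaMin ≤ β → β ≤ Real.exp (c / U ^ 2) →
      ∀ μ ∈ klWindowC, ∀ (ν : ℝ) (K : TrigPolyC4v), FrameOK R U (nScales β) ν K →
      ∀ (L M : ℕ) [NeZero L] [NeZero M] (J' : ℕ), 1 ≤ J' →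
      ∀ (j : ℕ) (c₁ c₁r : ℝ), J' ≤ j → 0 ≤ c₁ → 0 ≤ c₁r →
        (∀ (ω'' : Fin (sectorCount J')) (ω' : Fin (sectorCount 0)) (σ c : Fin 2) (x' : SpaceTimeIdx L M),
          ∑ x'' : SpaceTimeIdx L M, ‖(sectorAnalysisMatrix L M β (klAnisoFamily L M β μ K klE0 J') *
            sectorSubMatrix L M β (bgmFatMultiplier L M klE0 β (nambuXiCT L μ K) 0)) (x'', ((ω'', σ), c)) (x', ((ω', σ), c))‖ *
              klScaleWt L M β j
                {latticeLegPos (2 * (2 * M)) ((x'', ((ω'', σ), c)) : SpaceTimeIdx L M × SectorLeg (sectorCount J')),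
                  latticeLegPos (2 * (2 * M)) ((x', ((ω', σ), c)) : SpaceTimeIdx L M × SectorLeg (sectorCount 0))} ≤ c₁) →
        (∀ (ω'' : Fin (sectorCount J')) (ω' : Fin (sectorCount 0)) (σ c : Fin 2) (x'' : SpaceTimeIdx L M),
          ∑ x' : SpaceTimeIdx L M, ‖(sectorAnalysisMatrix L M β (klAnisoFamily L M β μ K klE0 J') *
            sectorSubMatrix L M β (bgmFatMultiplier L M klE0 β (nambuXiCT L μ K) 0)) (x'', ((ω'', σ), c)) (x', ((ω', σ), c))‖ *
              klScaleWt L M β j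
                {latticeLegPos (2 * (2 * M)) ((x'', ((ω'', σ), c)) : SpaceTimeIdx L M × SectorLeg (sectorCount J')),
                  latticeLegPos (2 * (2 * M)) ((x', ((ω', σ), c)) : SpaceTimeIdx L M × SectorLeg (sectorCount 0))} ≤ c₁r) →
      ∀ m : ℕ, 5 ≤ m → ∀ (q : Fin (m + 1)) (w : SpaceTimeIdx L M × SectorLeg (sectorCount J')) (N₀ : ℝ), 0 ≤ N₀ →
        (∀ w' : SpaceTimeIdx L M × SectorLeg (sectorCount 0), klWtPinnedSum L M β U μ K 0 (m + 1) q w' ≤ N₀) →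
        klWtPinnedSumAt L M β μ K J' j (m + 1) (klEffectiveAction L M β U μ K klE0 0) q w ≤
          c₁ ^ m * c₁r * imagTimeWeight β M ^ (m + 1) * (D ^ (m + 1) * 27 ^ (m + 1)) * ((2 : ℝ) ^ J') ^ (m - 2) * N₀ := by
  obtain ⟨D, hD, hreg⟩ := klWtPinnedSumAt_jump_le_of_overlap_abs
  refine ⟨D, hD, fun R hRj => ?_⟩
  obtain ⟨c₃, hc₃, U₀, hU₀, h⟩ := hreg R hRj
  refine ⟨c₃, hc₃, U₀, hU₀, ?_⟩
  intro c hc hc₃' U hU hU₀' β hβmin hβc μ hμ ν K hK L M _ _ J' hJ1 j c₁ c₁r hjJ hc₁0 hc₁r0 hcol₁ hrow₁ m hm q w N₀ hN0 hN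
  have hβ : 0 < β := KLRegimeSplit.pos_of_klBetaMin_le hβmin
  refine h c hc hc₃' U hU hU₀' β hβmin hβc μ hμ ν K hK L M 0 J' (by omega) (klEffectiveAction L M β U μ K klE0 0)
    (klEffectiveAction_momentumConserving β U μ K klE0 0) j c₁ c₁r hc₁0 hc₁r0 hcol₁ hrow₁ m hm q w N₀ hN0 fun w' => ?_
  calc klWtPinnedSumAt L M β μ K 0 j (m + 1) (klEffectiveAction L M β U μ K klE0 0) q w'
      ≤ klWtPinnedSumOf L M β μ K 0 (m + 1) (klEffectiveAction L M β U μ K klE0 0) q w' :=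
        klWtPinnedSumAt_le_klWtPinnedSumOf hβ.le μ K (Nat.zero_le j) (m + 1) _ q w'
    _ = klWtPinnedSum L M β U μ K 0 (m + 1) q w' := klWtPinnedSumOf_klEffectiveAction β U μ K 0 (m + 1) q w'
    _ ≤ N₀ := hN w'

/-- **THE SCALE-`0` ACTION `𝒱_0[K_n]` RE-MEASURED AT `F_{J′}`, WEIGHTED TRACK, SECOND CONSERVATION GAIN, at the flow frame on p3's deep window** (`1 ≤ J′ ≤ n`,
`4ⁿ·U ≤ 4^{2+dd}`, rate `j ≥ J′`; binders of `klWtPinnedSumAt_jump_le_klEng_flow_deep_abs` at `k = 0`): `klWtPinnedSumAt … J′ j (m+1) 𝒱_0 q w ≤ C_m·(2^{J′})^{m−2}·N₀`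
whenever the level-`0` weighted carriers `klWtPinnedSum … K_n 0 (m+1) q w′` are `≤ N₀`.  (Below the deep window the caller uses the `_of_overlap_abs` form with the
window-free overlap supplier.) [cite: BenfattoGiulianiMastropietro2006, §2.8 (2.82)-(2.84); BenfattoGiulianiMastropietro2003, §3.1 Lemma 3.1 (4.3)] -/
theorem klWtPinnedSumAt_scaleZero_remeasure_le_klEng_flow_deep_abs (dd m : ℕ) (hm : 5 ≤ m) :
    ∃ C : ℝ, 0 < C ∧ ∀ R : RenConsts, R.WF2 → ∃ c₃' : ℝ, 0 < c₃' ∧ ∃ U₀' : ℝ, 0 < U₀' ∧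
      ∀ (G : GeoConsts) (P : SplitConsts) (Q : EngConsts) (cc : ℝ), 0 < cc → cc ≤ klEngC₃6 P R → cc ≤ c₃' →
      ∀ μ ∈ klWindowC, ∀ U : ℝ, 0 < U → U ≤ min (klEngU₀3 P R cc) (1 / (R.Gfr 3 + 1)) → U ≤ U₀' →
      ∀ β : ℝ, klBetaMin ≤ β → β ≤ Real.exp (cc / U ^ 2) →
      ∀ (L M : ℕ) [NeZero L] [NeZero M], klEngL₃ β U ≤ L → klEngM₃ β U L ≤ M →
      ∀ n : ℕ, 1 ≤ n → n ≤ nScales β + 1 →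
        HistP klPredsV17F2 L M G P Q R β U μ 0 n → FrameOK R U (nScales β) μ (klFlowFrameU L M β U μ n) →
        ∀ J' : ℕ, 1 ≤ J' → J' ≤ n → (4 : ℝ) ^ n * U ≤ (4 : ℝ) ^ (2 + dd) →
        ∀ j : ℕ, J' ≤ j → ∀ (q : Fin (m + 1)) (w : SpaceTimeIdx L M × SectorLeg (sectorCount J')) (N₀ : ℝ), 0 ≤ N₀ →
          (∀ w' : SpaceTimeIdx L M × SectorLeg (sectorCount 0),
            klWtPinnedSum L M β U μ (klFlowFrameU L M β U μ n) 0 (m + 1) q w' ≤ N₀) →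
          klWtPinnedSumAt L M β μ (klFlowFrameU L M β U μ n) J' j (m + 1)
              (klEffectiveAction L M β U μ (klFlowFrameU L M β U μ n) klE0 0) q w ≤ C * ((2 : ℝ) ^ J') ^ (m - 2) * N₀ := by
  obtain ⟨C, hC, h⟩ := klWtPinnedSumAt_jump_le_klEng_flow_deep_abs dd m hm
  refine ⟨C, hC, fun R hR2 => ?_⟩
  obtain ⟨c₃, hc₃, U₀, hU₀, h'⟩ := h R hR2
  refine ⟨c₃, hc₃, U₀, hU₀, ?_⟩
  intro G P Q cc hcc hcc6 hcc₃' μ hμ U hU hUle hU₀' β hβmin hβc L M _ _ hL3 hM3 n hn1 hnN hhist hfr J' hJ1 hJn hwin j hjJ q w N₀ hN0 hN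
  have hβ : 0 < β := KLRegimeSplit.pos_of_klBetaMin_le hβmin
  set K : TrigPolyC4v := klFlowFrameU L M β U μ n with hK
  refine h' G P Q cc hcc hcc6 hcc₃' μ hμ U hU hUle hU₀' β hβmin hβc L M hL3 hM3 n hn1 hnN hhist hfr 0 J' (by omega) hJn (by simpa using hwin)
    (klEffectiveAction L M β U μ K klE0 0) (klEffectiveAction_momentumConserving β U μ K klE0 0) j hjJ q w N₀ hN0 fun w' => ?_
  calc klWtPinnedSumAt L M β μ K 0 j (m + 1) (klEffectiveAction L M β U μ K klE0 0) q w'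
      ≤ klWtPinnedSumOf L M β μ K 0 (m + 1) (klEffectiveAction L M β U μ K klE0 0) q w' :=
        klWtPinnedSumAt_le_klWtPinnedSumOf hβ.le μ K (Nat.zero_le j) (m + 1) _ q w'
    _ = klWtPinnedSum L M β U μ K 0 (m + 1) q w' := klWtPinnedSumOf_klEffectiveAction β U μ K 0 (m + 1) q w'
    _ ≤ N₀ := hN w'

end Summit.HubbardSuperconductivity.HubbardSuperconductivity.Theorems.EngineV8

end
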